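import Summits.HodgeConjecture.HodgeConjecture.Theses.AnchorTransport
import Literature.AlgebraicGeometry.HodgeTheory.GysinFormalismCorrespondences

/-!
# Route AnchorTransport — `IsoInvariance` (item stmt-HodgeConjecture-1078, shared with HeckePrymWeil)

The support item `IsoInvariance` is wanted, with the identical statement, by the routes
`AnchorTransport` and `HeckePrymWeil`.  This file records the proof against the `AnchorTransport`
copy of the decl: for `e : X ≅ Y` in `Over (Spec ℂ)`, `e^*(algebraicClasses Y p) ⊆
algebraicClasses X p`, because `e.hom.left` is an isomorphism of schemes, hence an open immersion,
so codimension of points is preserved (`AlgebraicGeometry.coheight_eq_of_isOpenImmersion`) and a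
class dying off a closed `Z ⊆ Y` of codimension `≥ p` pulls back to one dying off the closed
`e⁻¹Z` of codimension `≥ p` (`complexBetti.restrictCompl_map_eq_zero`).  Self-contained (it does
not import the HeckePrymWeil theorem file, so that the two route files are never imported together).
-/

noncomputable section

open CategoryTheory AlgebraicGeometry
open Literature.AlgebraicGeometry Literature.AlgebraicGeometry.HodgeTheory

namespace Summit.HodgeConjecture.HodgeConjecture.Theorems

/-- **Item stmt-HodgeConjecture-1078 (`IsoInvariance`), `AnchorTransport` copy**: for an
isomorphism `e : X ≅ Y` of `ℂ`-schemes, `p : ℕ` and `c ∈ algebraicClasses Y p`,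
`e^* c ∈ algebraicClasses X p`.  Generator-wise: a class dying on `(Y ∖ Z)(ℂ)`, `Z` closed of
codimension `≥ p`, pulls back to a class dying on `(X ∖ e⁻¹Z)(ℂ)`, and `codim x = codim e(x)`
for every point `x` since `e.hom.left` is an open immersion.  The type is literally the route decl
`Summit.HodgeConjecture.HodgeConjecture.Theses.AnchorTransport.IsoInvariance`.
[cite: Fulton1998, §19.1] -/
theorem anchorTransport_isoInvariance_proof :
    Summit.HodgeConjecture.HodgeConjecture.Theses.AnchorTransport.IsoInvariance := by
  unfold Summit.HodgeConjecture.HodgeConjecture.Theses.AnchorTransport.IsoInvariance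
  intro X Y e p c hc
  suffices h : algebraicClasses Y p ≤
      (algebraicClasses X p).comap (complexBetti.map e.hom (2 * p)).hom from h hc
  refine iSup_le fun S ↦ iSup_le fun hS ↦ iSup_le fun hp ↦ fun z hz ↦ ?_
  rw [LinearMap.mem_ker] at hz
  refine mem_supportedClasses_of_restrictCompl_eq_zero (hS.preimage e.hom.left.base.hom.continuous)
    (fun w hw ↦ (hp _ hw).trans (coheight_eq_of_isOpenImmersion e.hom.left).le) ?_
  exact complexBetti.restrictCompl_map_eq_zero e.hom hz

end Summit.HodgeConjecture.HodgeConjecture.Theorems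

end
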